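import Literature.Geometry.Symplectic.JSphereFamilyLeafFunction

/-!
# The orientation sign of a leaf submersion is constant along an immersed `J`-curve in its zero set
(registered helper `helper_leafSignConstant` of line `cross-cap-laurent`, crux
`GromovRecognitionRelEnd`, item stmt-SmoothPoincare4-11009; it serves the child stub
`stub_normalVelocityDichotomy` of the local-foliation fact, item stmt-SmoothPoincare4-16778)

Setting (C. Wendl, *Holomorphic Curves in Low Dimensions*, LNM 2216 (2018), Prop. 2.53): `X` an
almost complex `4`-manifold with almost complex structure `JX`, `πN : X → ℂ` smooth on the open set
`N`, and `w₀ : ℂ → X` a smooth immersed `JX`-holomorphic curve lying in the zero set `{πN = 0} ∩ N`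
along which `dπN` is onto.  At a point `y = w₀ z` the ORIENTATION SIGN of the real-linear
`dπN_y : T_y X → ℂ` relative to `JX` is the sign of `Im (dπN_y (JX V) · conj (dπN_y V))` for any
`V ∉ ker dπN_y`; it does not depend on `V` because `ker dπN_y = dw₀_z(ℂ)` is `JX`-invariant
(`Literature.Geometry.Symplectic.im_mul_conj_pos_iff`).  In the proof of Prop. 2.53 this sign is
the sign of the local index of a zero of the normal velocity of a family of `J`-spheres, and one
needs that it is the SAME at all points of the sphere.

Claim (`helper_leafSignConstant`): either the sign is `+` at every point `w₀ z`, or it is `-` at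
every point `w₀ z` (stated as a global dichotomy over all `z : ℂ` and all `V ∉ ker dπN_{w₀ z}`).

Proof.
* `LeafSignConstant.mfderiv_apply_J_eq_zero` — `ker dπN_{w₀ z}` is `JX`-invariant: it equals
  `dw₀_z(ℂ)` (`dπN ∘ dw₀ = d(πN ∘ w₀) = 0` by the chain rule since `πN ∘ w₀ ≡ 0`, `dw₀_z` is
  injective, `dπN_{w₀ z}` is onto, and `dim_ℝ T_{w₀ z} X = 4 = 2 + 2`:
  `LeafSignConstant.exists_preimage_of_apply_eq_zero`), and `JX (dw₀ ζ) = dw₀ (i ζ)` because `w₀`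
  is `JX`-holomorphic.
* `LeafSignConstant.eventually_posAt_iff_of_ker` — the tree's local constancy argument
  `Literature.Geometry.Symplectic.eventually_posAt_iff`, with the `JX`-invariance of the kernel at
  the moving point turned into a hypothesis inside the `∀ᶠ`: in the chart `φ` at `y₀` the sign at `y`
  is the sign of the continuous non-vanishing `y ↦ D(πN ∘ φ⁻¹)(φ y)(Ĵ(y) e) · conj (D(πN ∘ φ⁻¹)(φ y) e)`
  (`Ĵ` the frame expression `inTangentCoordinates` of `JX`, continuous at `y₀`).  Pulled back along
  the continuous `w₀` it gives: the sign at `w₀ z` is locally constant in `z`.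
* `LeafSignConstant.forall_or_forall_not` — a predicate on the connected `ℂ` which is locally
  constant holds everywhere or nowhere (`{z | P z ↔ P 0}` is clopen); in the second case the sign is
  `-` at every `V ∉ ker` by `im_mul_conj_ne_zero` / `posAt_iff`.

References: C. Wendl, *Holomorphic Curves in Low Dimensions*, LNM 2216 (2018), Prop. 2.53 (proof
sketch p. 65–66) [Wendl2018] — context only; the statement proved here is differential-topological
bookkeeping.  No new definitions, notation or instances.
-/

noncomputable section

open scoped Manifold ContDiff Topology ComplexConjugate
open Set Function Filter Complex Literature.Geometry.Symplectic

-- the prescribed namespace `Summit.<P>.<Sub>.…` duplicates `SmoothPoincare4` (P = Sub)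
set_option linter.dupNamespace false

namespace Summit.SmoothPoincare4.SmoothPoincare4.Theorems.GromovRecognitionRelEnd.CrossCapLaurent

namespace LeafSignConstant

variable {X : Type} [TopologicalSpace X] [ChartedSpace (EuclideanSpace ℝ (Fin 4)) X]
  [IsManifold (𝓡 4) ∞ X]

/-! ### The kernel of `dπN` along the curve is the (complex) tangent line of the curve -/

/-- **Dimension count.** For real-linear `D : ℂ → F`, `Λ : F → ℂ` with `dim_ℝ F = 4`, `D` injective,
`Λ` onto and `Λ ∘ D = 0`, the kernel of `Λ` is the range of `D` (both have dimension `2` and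
`range D ≤ ker Λ`); stated as: every `v ∈ ker Λ` is some `D u`. [folklore] -/
theorem exists_preimage_of_apply_eq_zero {F : Type*} [AddCommGroup F] [Module ℝ F]
    (h4 : Module.finrank ℝ F = 4) (D : ℂ →ₗ[ℝ] F) (Λ : F →ₗ[ℝ] ℂ) (hD : Injective D)
    (hΛ : Surjective Λ) (hcomp : ∀ w : ℂ, Λ (D w) = 0) {v : F} (hv : Λ v = 0) :
    ∃ u : ℂ, D u = v := by
  have : FiniteDimensional ℝ F := Module.finite_of_finrank_pos (by omega)
  have hk : LinearMap.ker Λ = LinearMap.range D := by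
    symm
    apply Submodule.eq_of_le_of_finrank_eq
    · rintro _ ⟨w, rfl⟩
      exact hcomp w
    · have h1 : Module.finrank ℝ (LinearMap.range D) = 2 := by
        rw [LinearMap.finrank_range_of_inj hD, finrank_real_complex]
      have h2 := LinearMap.finrank_range_add_finrank_ker Λ
      rw [LinearMap.range_eq_top.2 hΛ, finrank_top, finrank_real_complex, h4] at h2
      omega
  have hv' : v ∈ LinearMap.ker Λ := hv
  rw [hk] at hv'
  exact hv'

omit [IsManifold (𝓡 4) ∞ X] in
/-- **Chain rule along the zero set**: if the smooth curve `w₀` lies in `{πN = 0} ∩ N` with `πN`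
smooth on the open `N`, then `dπN_{w₀ z} ∘ dw₀_z = d(πN ∘ w₀)_z = 0`. [folklore] -/
theorem mfderiv_apply_mfderiv_eq_zero {w₀ : ℂ → X} {N : Set X} {πN : X → ℂ} (hN : IsOpen N)
    (hπ : ContMDiffOn (𝓡 4) 𝓘(ℝ, ℂ) ∞ πN N) (hw₀ : ContMDiff 𝓘(ℝ, ℂ) (𝓡 4) ∞ w₀)
    (hon : ∀ z : ℂ, w₀ z ∈ N ∧ πN (w₀ z) = 0) (z : ℂ) (u : ℂ) :
    mfderiv (𝓡 4) 𝓘(ℝ, ℂ) πN (w₀ z) (mfderiv 𝓘(ℝ, ℂ) (𝓡 4) w₀ z u) = 0 := by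
  have hπd : MDifferentiableAt (𝓡 4) 𝓘(ℝ, ℂ) πN (w₀ z) :=
    (hπ.contMDiffAt (hN.mem_nhds (hon z).1)).mdifferentiableAt (by simp)
  have hwd : MDifferentiableAt 𝓘(ℝ, ℂ) (𝓡 4) w₀ z := (hw₀ z).mdifferentiableAt (by simp)
  have h := mfderiv_comp z hπd hwd
  have h0 : (πN ∘ w₀) = fun _ => (0 : ℂ) := funext fun z => (hon z).2
  rw [h0, mfderiv_const] at h
  exact (DFunLike.congr_fun h u).symm

/-- **`JX`-invariance of `ker dπN` at the points of the curve.** With `w₀` a smooth immersed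
`JX`-holomorphic curve in `{πN = 0} ∩ N` and `dπN_{w₀ z}` onto: `ker dπN_{w₀ z} = dw₀_z(ℂ)`
(dimension count) is `JX`-invariant, since `JX (dw₀_z ζ) = dw₀_z (i ζ)`. [folklore] -/
theorem mfderiv_apply_J_eq_zero (JX : AlmostComplexStructure (𝓡 4) ∞ X) {w₀ : ℂ → X} {N : Set X}
    {πN : X → ℂ} (hN : IsOpen N) (hπ : ContMDiffOn (𝓡 4) 𝓘(ℝ, ℂ) ∞ πN N)
    (hw₀ : ContMDiff 𝓘(ℝ, ℂ) (𝓡 4) ∞ w₀) (hJ : IsJHolomorphic (𝓡 4) (fun y => JX y) w₀) {z : ℂ}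
    (hinj : Injective (mfderiv 𝓘(ℝ, ℂ) (𝓡 4) w₀ z)) (hon : ∀ z : ℂ, w₀ z ∈ N ∧ πN (w₀ z) = 0)
    (hsurj : Surjective (mfderiv (𝓡 4) 𝓘(ℝ, ℂ) πN (w₀ z))) {v : TangentSpace (𝓡 4) (w₀ z)}
    (hv : mfderiv (𝓡 4) 𝓘(ℝ, ℂ) πN (w₀ z) v = 0) :
    mfderiv (𝓡 4) 𝓘(ℝ, ℂ) πN (w₀ z) (JX (w₀ z) v) = 0 := by
  have hcomp := mfderiv_apply_mfderiv_eq_zero hN hπ hw₀ hon z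
  have h4 : Module.finrank ℝ (TangentSpace (𝓡 4) (w₀ z)) = 4 := finrank_euclideanSpace_fin
  obtain ⟨u, hu⟩ := exists_preimage_of_apply_eq_zero h4 (mfderiv 𝓘(ℝ, ℂ) (𝓡 4) w₀ z).toLinearMap
    (mfderiv (𝓡 4) 𝓘(ℝ, ℂ) πN (w₀ z)).toLinearMap hinj hsurj hcomp hv
  have hu' : mfderiv 𝓘(ℝ, ℂ) (𝓡 4) w₀ z u = v := hu
  have hJu : JX (w₀ z) (mfderiv 𝓘(ℝ, ℂ) (𝓡 4) w₀ z u) =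
      mfderiv 𝓘(ℝ, ℂ) (𝓡 4) w₀ z (Complex.I * u) := (hJ z u).symm
  rw [← hu', hJu]
  exact hcomp _

/-! ### Local constancy of the orientation sign, with pointwise `J`-invariance of the kernel -/

/-- **Local constancy of the orientation sign** (the tree's `eventually_posAt_iff` with the
`J`-invariance of the kernel at the moving point `y` as a hypothesis inside the `∀ᶠ`): for `A`
smooth at `y₀` with `dA_{y₀}` onto and `ker dA_{y₀}` `J`-invariant, for all `y` near `y₀` AT WHICH
`ker dA_y` is `J`-invariant, the sign of `Im (dA_y (J v) · conj (dA_y v))` (`v ∉ ker dA_y`) is that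
at `y₀`: in the chart `φ` at `y₀` it is the sign of the continuous non-vanishing
`y ↦ D(A ∘ φ⁻¹)(φ y)(Ĵ(y) e) · conj (D(A ∘ φ⁻¹)(φ y) e)`. [folklore] -/
theorem eventually_posAt_iff_of_ker (JX : AlmostComplexStructure (𝓡 4) ∞ X) {A : X → ℂ} {y₀ : X}
    (hA : ContMDiffAt (𝓡 4) 𝓘(ℝ, ℂ) ∞ A y₀)
    (hsurj : Surjective (mfderiv (𝓡 4) 𝓘(ℝ, ℂ) A y₀))
    (hker₀ : ∀ v, mfderiv (𝓡 4) 𝓘(ℝ, ℂ) A y₀ v = 0 → mfderiv (𝓡 4) 𝓘(ℝ, ℂ) A y₀ (JX y₀ v) = 0) :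
    ∀ᶠ y in 𝓝 y₀,
      (∀ v, mfderiv (𝓡 4) 𝓘(ℝ, ℂ) A y v = 0 → mfderiv (𝓡 4) 𝓘(ℝ, ℂ) A y (JX y v) = 0) →
      ((∀ v, mfderiv (𝓡 4) 𝓘(ℝ, ℂ) A y v ≠ 0 →
          0 < ((show ℂ from mfderiv (𝓡 4) 𝓘(ℝ, ℂ) A y (JX y v)) *
            conj (show ℂ from mfderiv (𝓡 4) 𝓘(ℝ, ℂ) A y v)).im) ↔
        (∀ v, mfderiv (𝓡 4) 𝓘(ℝ, ℂ) A y₀ v ≠ 0 →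
          0 < ((show ℂ from mfderiv (𝓡 4) 𝓘(ℝ, ℂ) A y₀ (JX y₀ v)) *
            conj (show ℂ from mfderiv (𝓡 4) 𝓘(ℝ, ℂ) A y₀ v)).im)) := by
  -- adapted from `Literature.Geometry.Symplectic.eventually_posAt_iff`
  dsimp only
  set φ := extChartAt (𝓡 4) y₀ with hφ
  set Ah : EuclideanSpace ℝ (Fin 4) → ℂ := A ∘ φ.symm with hAh
  have hÂ : ContDiffAt ℝ ∞ Ah (φ y₀) := contDiffAt_comp_extChartAt_symm hA
  have hÂ1 : ContDiffAt ℝ 1 Ah (φ y₀) := hÂ.of_le (by exact_mod_cast le_top)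
  have hdiff : ∀ᶠ x in 𝓝 (φ y₀), DifferentiableAt ℝ Ah x :=
    (hÂ1.eventually (by simp)).mono fun x hx => hx.differentiableAt one_ne_zero
  have hdiff' : ∀ᶠ y in 𝓝 y₀, DifferentiableAt ℝ Ah (φ y) :=
    (continuousAt_extChartAt (I := 𝓡 4) y₀).eventually hdiff
  have hsrc : ∀ᶠ y in 𝓝 y₀, y ∈ φ.source := extChartAt_source_mem_nhds (I := 𝓡 4) y₀
  -- the frame expression of `J` in the chart at `y₀`
  set Jin : X → EuclideanSpace ℝ (Fin 4) →L[ℝ] EuclideanSpace ℝ (Fin 4) :=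
    inTangentCoordinates (𝓡 4) (𝓡 4) (id : X → X) id
      (fun x => (JX x : TangentSpace (𝓡 4) x →L[ℝ] TangentSpace (𝓡 4) x)) y₀ with hJin
  have hJc : ContinuousAt Jin y₀ := (JX.contMDiffAt_inTangentCoordinates y₀).continuousAt
  -- a vector `e` with `dA_{y₀} (B e) ≠ 0`
  obtain ⟨w, hw⟩ := hsurj (1 : ℂ)
  set e : EuclideanSpace ℝ (Fin 4) :=
    mfderiv (𝓡 4) 𝓘(ℝ, EuclideanSpace ℝ (Fin 4)) φ y₀ w with he
  -- the continuous function
  set F : X → ℂ := fun y => fderiv ℝ Ah (φ y) (Jin y e) * conj (fderiv ℝ Ah (φ y) e) with hF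
  have hc1 : ContinuousAt (fun y => fderiv ℝ Ah (φ y)) y₀ :=
    ContinuousAt.comp (f := φ) (g := fderiv ℝ Ah) (hÂ.continuousAt_fderiv (by simp))
      (continuousAt_extChartAt (I := 𝓡 4) y₀)
  have hFc : ContinuousAt F y₀ :=
    (hc1.clm_apply (hJc.clm_apply continuousAt_const)).mul
      (Complex.continuous_conj.continuousAt.comp (hc1.clm_apply continuousAt_const))
  -- the key identities at points near `y₀`
  have key : ∀ y, y ∈ φ.source → DifferentiableAt ℝ Ah (φ y) →
      mfderiv (𝓡 4) 𝓘(ℝ, ℂ) A y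
          (mfderivWithin 𝓘(ℝ, EuclideanSpace ℝ (Fin 4)) (𝓡 4) φ.symm (range (𝓡 4)) (φ y) e) =
        fderiv ℝ Ah (φ y) e ∧
      mfderiv (𝓡 4) 𝓘(ℝ, ℂ) A y (JX y
          (mfderivWithin 𝓘(ℝ, EuclideanSpace ℝ (Fin 4)) (𝓡 4) φ.symm (range (𝓡 4)) (φ y) e)) =
        fderiv ℝ Ah (φ y) (Jin y e) := by
    intro y hy hd
    have hy' : y ∈ (chartAt (EuclideanSpace ℝ (Fin 4)) y₀).source := by
      rwa [← extChartAt_source (I := 𝓡 4)]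
    have h1 := mfderiv_eq_fderiv_comp_mfderiv_extChartAt hy hd
    have h2 := mfderiv_extChartAt_comp_mfderivWithin_extChartAt_symm' (I := 𝓡 4) hy
    have h3 := inTangentCoordinates_eq_mfderiv_comp (I := 𝓡 4) (I' := 𝓡 4) (f := (id : X → X))
      (g := (id : X → X))
      (ϕ := fun x => (JX x : TangentSpace (𝓡 4) x →L[ℝ] TangentSpace (𝓡 4) x)) (x₀ := y₀)
      (x := y) hy' hy'
    constructor
    · rw [h1]
      exact congrArg (fderiv ℝ Ah (φ y)) (DFunLike.congr_fun h2 e)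
    · rw [h1]
      exact congrArg (fderiv ℝ Ah (φ y)) (DFunLike.congr_fun h3 e).symm
  -- at `y₀`
  have hsrc₀ : y₀ ∈ φ.source := mem_extChartAt_source (I := 𝓡 4) y₀
  have hd₀ : DifferentiableAt ℝ Ah (φ y₀) := hÂ.differentiableAt (by simp)
  have hBe : mfderivWithin 𝓘(ℝ, EuclideanSpace ℝ (Fin 4)) (𝓡 4) φ.symm (range (𝓡 4)) (φ y₀) e =
      w :=
    DFunLike.congr_fun (mfderivWithin_extChartAt_symm_comp_mfderiv_extChartAt' (I := 𝓡 4) hsrc₀) w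
  obtain ⟨k1, k2⟩ := key y₀ hsrc₀ hd₀
  rw [hBe] at k1 k2
  have hF₀ : F y₀ = (show ℂ from mfderiv (𝓡 4) 𝓘(ℝ, ℂ) A y₀ (JX y₀ w)) *
      conj (show ℂ from mfderiv (𝓡 4) 𝓘(ℝ, ℂ) A y₀ w) := by
    dsimp only
    rw [hF, k1, k2]
  have hw0 : mfderiv (𝓡 4) 𝓘(ℝ, ℂ) A y₀ w ≠ 0 := fun h0 =>
    one_ne_zero (α := ℂ) (hw.symm.trans h0)
  have hF₀ne : (F y₀).im ≠ 0 := by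
    rw [hF₀]
    set L : TangentSpace (𝓡 4) y₀ →ₗ[ℝ] ℂ := (mfderiv (𝓡 4) 𝓘(ℝ, ℂ) A y₀).toLinearMap with hL
    set Jl : TangentSpace (𝓡 4) y₀ →ₗ[ℝ] TangentSpace (𝓡 4) y₀ :=
      (JX y₀ : TangentSpace (𝓡 4) y₀ →L[ℝ] TangentSpace (𝓡 4) y₀).toLinearMap with hJl
    exact im_mul_conj_ne_zero Jl L (fun w => JX.map_map y₀ w) (fun w hw => hker₀ w hw) hw0
  -- the sign of `Im F` persists near `y₀`
  have hsign : ∀ᶠ y in 𝓝 y₀, (0 < (F y).im ↔ 0 < (F y₀).im) ∧ (F y).im ≠ 0 := by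
    have hFi : ContinuousAt (fun y => (F y).im) y₀ := Complex.continuous_im.continuousAt.comp hFc
    rcases lt_or_gt_of_ne hF₀ne with h | h
    · filter_upwards [hFi.eventually (gt_mem_nhds h)] with y hy
      exact ⟨⟨fun h' => absurd h' (not_lt.2 hy.le), fun h' => absurd h' (not_lt.2 h.le)⟩, hy.ne⟩
    · filter_upwards [hFi.eventually (lt_mem_nhds h)] with y hy
      exact ⟨⟨fun _ => h, fun _ => hy⟩, hy.ne'⟩
  filter_upwards [hdiff', hsrc, hsign] with y hd hy ⟨hs, hne⟩ hkery
  obtain ⟨e1, e2⟩ := key y hy hd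
  set v : TangentSpace (𝓡 4) y :=
    mfderivWithin 𝓘(ℝ, EuclideanSpace ℝ (Fin 4)) (𝓡 4) φ.symm (range (𝓡 4)) (φ y) e with hv
  have hFy : F y = (show ℂ from mfderiv (𝓡 4) 𝓘(ℝ, ℂ) A y (JX y v)) *
      conj (show ℂ from mfderiv (𝓡 4) 𝓘(ℝ, ℂ) A y v) := by
    dsimp only
    rw [hF, e1, e2]
  have hfe : fderiv ℝ Ah (φ y) e ≠ 0 := by
    intro h0
    apply hne
    simp only [hF, h0, map_zero, mul_zero, Complex.zero_im]
  have hv0 : mfderiv (𝓡 4) 𝓘(ℝ, ℂ) A y v ≠ 0 := by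
    rw [e1]
    exact hfe
  rw [posAt_iff JX hkery hv0, posAt_iff JX hker₀ hw0, ← hFy, ← hF₀]
  exact hs

/-! ### Globalisation over the connected parameter plane -/

/-- **A locally constant predicate on `ℂ` holds everywhere or nowhere**: `{z | P z ↔ P 0}` is
clopen and non-empty in the connected `ℂ`. [folklore] -/
theorem forall_or_forall_not {P : ℂ → Prop} (hloc : ∀ z₀ : ℂ, ∀ᶠ z in 𝓝 z₀, (P z ↔ P z₀)) :
    (∀ z, P z) ∨ (∀ z, ¬ P z) := by
  have hS : IsClopen {z : ℂ | P z ↔ P 0} := by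
    constructor
    · rw [← isOpen_compl_iff, isOpen_iff_mem_nhds]
      intro z hz
      filter_upwards [hloc z] with x hx
      simp only [mem_compl_iff, mem_setOf_eq] at hz ⊢
      tauto
    · rw [isOpen_iff_mem_nhds]
      intro z hz
      filter_upwards [hloc z] with x hx
      simp only [mem_setOf_eq] at hz ⊢
      tauto
  have h := hS.eq_univ ⟨0, Iff.rfl⟩
  have hall : ∀ z, (P z ↔ P 0) := fun z => (h ▸ mem_univ z : z ∈ {z : ℂ | P z ↔ P 0})
  by_cases h0 : P 0
  · exact Or.inl fun z => (hall z).2 h0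
  · exact Or.inr fun z hPz => h0 ((hall z).1 hPz)

end LeafSignConstant

open LeafSignConstant

/-- **Registered helper `helper_leafSignConstant`: the orientation sign of `dπN` relative to `JX`
is constant along an immersed `JX`-holomorphic curve lying in `{πN = 0}`** (bookkeeping in the
proof of Wendl 2018, Prop. 2.53).  For `πN` smooth on the open `N`, `w₀ : ℂ → X` a smooth immersed
`JX`-holomorphic curve with `w₀ z ∈ N`, `πN (w₀ z) = 0` and `dπN_{w₀ z}` onto for all `z`: EITHER
`0 < Im (dπN (JX V) · conj (dπN V))` for all `z` and all `V ∉ ker dπN_{w₀ z}`, OR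
`Im (dπN (JX V) · conj (dπN V)) < 0` for all `z` and all such `V`. [cite: Wendl2018, Prop. 2.53] -/
theorem helper_leafSignConstant : ∀ (X : Type) [TopologicalSpace X] [T2Space X] [SecondCountableTopology X] [ChartedSpace (EuclideanSpace ℝ (Fin 4)) X] [IsManifold (𝓡 4) ∞ X] (JX : Literature.Geometry.Symplectic.AlmostComplexStructure (𝓡 4) ∞ X) (w₀ : ℂ → X) (N : Set X) (πN : X → ℂ), IsOpen N → ContMDiffOn (𝓡 4) 𝓘(ℝ, ℂ) ∞ πN N → ContMDiff 𝓘(ℝ, ℂ) (𝓡 4) ∞ w₀ → Literature.Geometry.Symplectic.IsJHolomorphic (𝓡 4) (fun y => JX y) w₀ → (∀ z : ℂ, Function.Injective (mfderiv 𝓘(ℝ, ℂ) (𝓡 4) w₀ z)) → (∀ z : ℂ, w₀ z ∈ N ∧ πN (w₀ z) = 0) → (∀ z : ℂ, Function.Surjective (mfderiv (𝓡 4) 𝓘(ℝ, ℂ) πN (w₀ z))) → (∀ z : ℂ, ∀ V : TangentSpace (𝓡 4) (w₀ z), mfderiv (𝓡 4) 𝓘(ℝ, ℂ) πN (w₀ z)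 V ≠ 0 → 0 < ((show ℂ from mfderiv (𝓡 4) 𝓘(ℝ, ℂ) πN (w₀ z) (JX (w₀ z) V)) * (starRingEnd ℂ) (show ℂ from mfderiv (𝓡 4) 𝓘(ℝ, ℂ) πN (w₀ z) V)).im) ∨ (∀ z : ℂ, ∀ V : TangentSpace (𝓡 4) (w₀ z), mfderiv (𝓡 4) 𝓘(ℝ, ℂ) πN (w₀ z) V ≠ 0 → ((show ℂ from mfderiv (𝓡 4) 𝓘(ℝ, ℂ) πN (w₀ z) (JX (w₀ z) V)) * (starRingEnd ℂ) (show ℂ from mfderiv (𝓡 4) 𝓘(ℝ, ℂ) πN (w₀ z) V)).im < 0) := by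
  intro X _ _ _ _ _ JX w₀ N πN hN hπ hw₀ hJ hinj hon hsurj
  -- `J`-invariance of `ker dπN` at every point of the curve
  have hker : ∀ (z : ℂ) (v : TangentSpace (𝓡 4) (w₀ z)), mfderiv (𝓡 4) 𝓘(ℝ, ℂ) πN (w₀ z) v = 0 →
      mfderiv (𝓡 4) 𝓘(ℝ, ℂ) πN (w₀ z) (JX (w₀ z) v) = 0 := fun z _ hv =>
    mfderiv_apply_J_eq_zero JX hN hπ hw₀ hJ (hinj z) hon (hsurj z) hv
  -- local constancy of the sign predicate in the parameter `z`, pulled back along `w₀`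
  have hloc : ∀ z₀ : ℂ, ∀ᶠ z in 𝓝 z₀,
      ((∀ V : TangentSpace (𝓡 4) (w₀ z), mfderiv (𝓡 4) 𝓘(ℝ, ℂ) πN (w₀ z) V ≠ 0 →
          0 < ((show ℂ from mfderiv (𝓡 4) 𝓘(ℝ, ℂ) πN (w₀ z) (JX (w₀ z) V)) *
            conj (show ℂ from mfderiv (𝓡 4) 𝓘(ℝ, ℂ) πN (w₀ z) V)).im) ↔
        (∀ V : TangentSpace (𝓡 4) (w₀ z₀), mfderiv (𝓡 4) 𝓘(ℝ, ℂ) πN (w₀ z₀) V ≠ 0 →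
          0 < ((show ℂ from mfderiv (𝓡 4) 𝓘(ℝ, ℂ) πN (w₀ z₀) (JX (w₀ z₀) V)) *
            conj (show ℂ from mfderiv (𝓡 4) 𝓘(ℝ, ℂ) πN (w₀ z₀) V)).im)) := fun z₀ => by
    have hA : ContMDiffAt (𝓡 4) 𝓘(ℝ, ℂ) ∞ πN (w₀ z₀) := hπ.contMDiffAt (hN.mem_nhds (hon z₀).1)
    have hev := eventually_posAt_iff_of_ker JX hA (hsurj z₀) (hker z₀)
    have hcont : ContinuousAt w₀ z₀ := hw₀.continuous.continuousAt
    exact (hcont.eventually hev).mono fun z hz => hz (hker z)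
  rcases forall_or_forall_not hloc with h | h
  · exact Or.inl h
  · refine Or.inr fun z V hV => ?_
    dsimp only
    set L : TangentSpace (𝓡 4) (w₀ z) →ₗ[ℝ] ℂ :=
      (mfderiv (𝓡 4) 𝓘(ℝ, ℂ) πN (w₀ z)).toLinearMap with hL
    set Jl : TangentSpace (𝓡 4) (w₀ z) →ₗ[ℝ] TangentSpace (𝓡 4) (w₀ z) :=
      (JX (w₀ z) : TangentSpace (𝓡 4) (w₀ z) →L[ℝ] TangentSpace (𝓡 4) (w₀ z)).toLinearMap with hJl
    have hne : (L (Jl V) * conj (L V)).im ≠ 0 :=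
      im_mul_conj_ne_zero Jl L (fun w => JX.map_map (w₀ z) w) (fun w hw => hker z w hw) hV
    rcases lt_or_gt_of_ne hne with hlt | hgt
    · exact hlt
    · exact absurd ((posAt_iff JX (hker z) hV).2 hgt) (h z)

end Summit.SmoothPoincare4.SmoothPoincare4.Theorems.GromovRecognitionRelEnd.CrossCapLaurent

end
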